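import Summits.Ventures.LatticeQCDFlow.Exactness.IMHAnyStartSplit
import Summits.Ventures.LatticeQCDFlow.Exactness.DoeblinObservables
import HarnessLib

/-!
# Total-variation contraction of flow-MCMC from every pair of starts: `|μ₀Kⁿ(B) − ν₀Kⁿ(B)| ≤ (1 − A)ⁿ·δ` whenever
# `|μ₀(C) − ν₀(C)| ≤ δ` on every measurable `C` (def-free Dobrushin coefficient `1 − A`)

HONEST FRAMING: exact (Metropolis-corrected) sampling algorithms for lattice gauge theory;
figures of merit are autocorrelation/cost numbers at stated couplings and volumes; no
continuum-physics claim.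

Venture `LatticeQCDFlow` (cell pub-lqcd), topic `Exactness`; FANOUT row 30 (lean-1, GEN-37).  NEW WORK of the cell,
general state space.  GEN-34 split the flow-MCMC chain `K = indepMH q w` (`w` normalised, maximal at `x₀`, `A = 1/w(x₀)`,
`r = 1 − A`) from every start, `μ₀Kⁿ = (1 − rⁿ)·π + rⁿ·μ₀Rⁿ` (`Exactness/IMHAnyStartSplit`), and recorded «NOT CLAIMED:
total-variation contraction `‖μ₀Kⁿ − π‖ ≤ rⁿ‖μ₀ − π‖` (true by the same split, not typed)»; GEN-35's `IMHTwoStarts` bounded two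
arbitrary starts by `rⁿ` without the factor `‖μ₀ − ν₀‖`.  This file types the contraction, DEF-FREE (no total-variation
functional is defined: the hypothesis is `|μ₀(C) − ν₀(C)| ≤ δ` for every measurable `C`, the conclusion the same with `rⁿδ`):

* §1 (any Markov kernel) **`abs_integral_sub_integral_le_mul_of_setwise`** — if `|μ(C) − ν(C)| ≤ δ` on measurable sets
  then `|∫ g dμ − ∫ g dν| ≤ (c − a)·δ` for every measurable `a ≤ g ≤ c` (probability measures; Hahn decomposition,
  Mathlib's `hahn_decomposition`; the `[0, 1]`-valued case is row 9's `DoeblinObservables.abs_integral_sub_integral_le_of_setwise`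
  by the layer-cake formula, reused below); **`bind_real_sub_abs_le`** — A MARKOV KERNEL DOES NOT EXPAND:
  `|μQ(B) − νQ(B)| ≤ δ`; **`iterate_bind_real_sub_abs_le`** — nor do its iterates.
* §2 **`iterate_bind_indepMH_real_sub_eq_residual`** — for `K = indepMH q w` (`w(x₀) > 1`):
  `μ₀Kⁿ(B) − ν₀Kⁿ(B) = rⁿ·(μ₀Rⁿ(B) − ν₀Rⁿ(B))` EXACTLY (`R` the residual kernel of `IMHAnyStartSplit`; the `π`-parts cancel);
  **`iterate_bind_indepMH_tv_contraction`** — THE CONTRACTION: for every pair of initial laws with `|μ₀(C) − ν₀(C)| ≤ δ` on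
  measurable sets, every `n` and measurable `B`: `|μ₀Kⁿ(B) − ν₀Kⁿ(B)| ≤ rⁿ·δ` (all `w(x₀) ≥ 1`; at `w(x₀) = 1` the sampler is
  i.i.d. and both sides vanish for `n ≥ 1`); **`integral_iterate_bind_indepMH_sub_abs_le_of_setwise`** — observables:
  `|E_{μ₀} g(X_n) − E_{ν₀} g(X_n)| ≤ rⁿ·δ·(c − a)` for measurable `a ≤ g ≤ c`.
* §3 **`iterate_bind_indepMH_tv_to_target`** — at `ν₀ = π`: `|μ₀Kⁿ(B) − π(B)| ≤ rⁿ·δ` whenever `|μ₀(C) − π(C)| ≤ δ` — the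
  rate `rⁿ` of `IMHAnyStartSplit` times the INITIAL total-variation distance (a warm start at distance `δ` needs
  `log(δ/ε)/A`, not `log(1/ε)/A`, updates); the coefficient `rⁿ` is attained by the cold start (GEN-31:
  `δ_{x₀}Kⁿ(B) − π(B) = rⁿ(1_B(x₀) − π(B))`, not re-proved here).
Reading (gauge files): two exact gauge samplers started from laws at total-variation distance `δ` stay within `(1 − A)ⁿδ`
set by set; the Dobrushin coefficient of the exact sampler is at most `1 − A`.
NOT CLAIMED: a total-variation functional or its attainment as a supremum (def-free throughout); that `1 − A` is the exact
Dobrushin coefficient (it is, for atom-free `q`, by GEN-31's cold row — not typed); Wasserstein or `L²` versions (GEN-35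
`IMHDensityStartL2`).  No `sorry`, no new definitions, nothing cited as a fact.
-/

noncomputable section

namespace Summit.Ventures.LatticeQCDFlow.Exactness

open MeasureTheory ProbabilityTheory Function
open scoped ENNReal
open Literature.Probability.MarkovChains

variable {Ω : Type*} [MeasurableSpace Ω] {q : Measure Ω} [IsProbabilityMeasure q] {w : Ω → ℝ}

/-! ## §1 Set-wise closeness passes to bounded observables and through Markov kernels -/

/-- **Set-wise closeness controls bounded observables** (Hahn decomposition): for probability measures `μ`, `ν` with
`|μ(C) − ν(C)| ≤ δ` for every measurable `C`, and measurable `a ≤ g ≤ c`: `|∫ g dμ − ∫ g dν| ≤ (c − a)·δ` (the `0 ≤ g ≤ 1`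
case is row 9's `DoeblinObservables.abs_integral_sub_integral_le_of_setwise`, by the layer-cake formula). [ours] -/
theorem abs_integral_sub_integral_le_mul_of_setwise (μ ν : Measure Ω) [IsProbabilityMeasure μ] [IsProbabilityMeasure ν]
    {δ : ℝ} (hδ : ∀ C, MeasurableSet C → |μ.real C - ν.real C| ≤ δ) {g : Ω → ℝ} (hg : Measurable g) {a c : ℝ}
    (ha : ∀ x, a ≤ g x) (hc : ∀ x, g x ≤ c) : |∫ x, g x ∂μ - ∫ x, g x ∂ν| ≤ (c - a) * δ := by
  obtain ⟨s, hs, h1, h2⟩ := hahn_decomposition μ ν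
  -- the Hahn set carries the distance: `d = μ(s) − ν(s) ∈ [0, δ]`
  have hd : μ.real s - ν.real s ≤ δ := (le_abs_self _).trans (hδ s hs)
  have hd0 : ν.real s ≤ μ.real s := by
    simp only [measureReal_def]
    exact ENNReal.toReal_mono (measure_ne_top _ _) (h1 s hs subset_rfl)
  -- restricted dominations
  have hle_s : ν.restrict s ≤ μ.restrict s := by
    refine Measure.le_iff.2 fun t ht => ?_
    rw [Measure.restrict_apply ht, Measure.restrict_apply ht]
    exact h1 _ (ht.inter hs) Set.inter_subset_right
  have hle_c : μ.restrict sᶜ ≤ ν.restrict sᶜ := by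
    refine Measure.le_iff.2 fun t ht => ?_
    rw [Measure.restrict_apply ht, Measure.restrict_apply ht]
    exact h2 _ (ht.inter hs.compl) Set.inter_subset_right
  -- integrability of `g − a ≥ 0` and `c − g ≥ 0`
  have hC : ∀ x, |g x| ≤ max |a| |c| := fun x => abs_le_max_abs_abs (ha x) (hc x)
  have hgi : ∀ (m : Measure Ω) [IsFiniteMeasure m], Integrable g m := fun m _ =>
    Summit.Ventures.LatticeQCDFlow.Scoring.integrable_of_bounded m hg hC
  have hgai : ∀ (m : Measure Ω) [IsFiniteMeasure m], Integrable (fun x => g x - a) m := fun m _ =>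
    (hgi m).sub (integrable_const a)
  have hcgi : ∀ (m : Measure Ω) [IsFiniteMeasure m], Integrable (fun x => c - g x) m := fun m _ =>
    (integrable_const c).sub (hgi m)
  have hga0 : ∀ x, 0 ≤ g x - a := fun x => sub_nonneg.2 (ha x)
  have hcg0 : ∀ x, 0 ≤ c - g x := fun x => sub_nonneg.2 (hc x)
  -- the four one-sided comparisons
  have hA1 : ∫ x in s, (g x - a) ∂ν ≤ ∫ x in s, (g x - a) ∂μ :=
    integral_mono_measure hle_s (ae_of_all _ hga0) (hgai _)
  have hA2 : ∫ x in s, (c - g x) ∂ν ≤ ∫ x in s, (c - g x) ∂μ :=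
    integral_mono_measure hle_s (ae_of_all _ hcg0) (hcgi _)
  have hB1 : ∫ x in sᶜ, (g x - a) ∂μ ≤ ∫ x in sᶜ, (g x - a) ∂ν :=
    integral_mono_measure hle_c (ae_of_all _ hga0) (hgai _)
  have hB2 : ∫ x in sᶜ, (c - g x) ∂μ ≤ ∫ x in sᶜ, (c - g x) ∂ν :=
    integral_mono_measure hle_c (ae_of_all _ hcg0) (hcgi _)
  -- evaluate them: `∫_t (g − a) dm = ∫_t g dm − a·m(t)`, `∫_t (c − g) dm = c·m(t) − ∫_t g dm`
  have hsub : ∀ (m : Measure Ω) [IsFiniteMeasure m] (t : Set Ω),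
      ∫ x in t, (g x - a) ∂m = ∫ x in t, g x ∂m - a * m.real t := by
    intro m _ t
    rw [integral_sub (hgi _) (integrable_const a), setIntegral_const, smul_eq_mul, mul_comm]
  have hsub' : ∀ (m : Measure Ω) [IsFiniteMeasure m] (t : Set Ω),
      ∫ x in t, (c - g x) ∂m = c * m.real t - ∫ x in t, g x ∂m := by
    intro m _ t
    rw [integral_sub (integrable_const c) (hgi _), setIntegral_const, smul_eq_mul, mul_comm]
  rw [hsub, hsub] at hA1 hB1
  rw [hsub', hsub'] at hA2 hB2
  -- complements: `m(sᶜ) = 1 − m(s)`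
  have hμc : μ.real sᶜ = 1 - μ.real s := by rw [measureReal_compl hs, probReal_univ]
  have hνc : ν.real sᶜ = 1 - ν.real s := by rw [measureReal_compl hs, probReal_univ]
  rw [hμc] at hB1 hB2
  rw [hνc] at hB1 hB2
  -- assemble `∫ g = ∫_s g + ∫_{sᶜ} g`
  rw [← integral_add_compl hs (hgi μ), ← integral_add_compl hs (hgi ν), abs_le]
  have hca : a ≤ c := by
    -- `Ω` is nonempty (a probability measure lives on it)
    by_contra hlt
    have hempty : (Set.univ : Set Ω) = ∅ := Set.univ_eq_empty_iff.2 ⟨fun x => hlt ((ha x).trans (hc x))⟩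
    have h := probReal_univ (μ := μ)
    rw [hempty, measureReal_empty] at h
    exact zero_ne_one h
  constructor <;> nlinarith [mul_nonneg (sub_nonneg.2 hca) (sub_nonneg.2 hd0)]

/-- **A MARKOV KERNEL DOES NOT EXPAND SET-WISE CLOSENESS**: `|μ(C) − ν(C)| ≤ δ` on measurable sets implies
`|μQ(B) − νQ(B)| ≤ δ` for every Markov kernel `Q` and measurable `B` (`μQ(B) = ∫ Q(x, B) dμ` with `0 ≤ Q(·, B) ≤ 1` and
row 9's observable transfer). [ours] -/
theorem bind_real_sub_abs_le (Q : Kernel Ω Ω) [IsMarkovKernel Q] (μ ν : Measure Ω) [IsProbabilityMeasure μ]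
    [IsProbabilityMeasure ν] {δ : ℝ} (hδ : ∀ C, MeasurableSet C → |μ.real C - ν.real C| ≤ δ) {B : Set Ω}
    (hB : MeasurableSet B) : |(μ.bind Q).real B - (ν.bind Q).real B| ≤ δ := by
  have hrepr : ∀ (m : Measure Ω), (m.bind Q).real B = ∫ x, (Q x).real B ∂m := by
    intro m
    simp only [measureReal_def]
    rw [Measure.bind_apply hB (Kernel.aemeasurable _),
      integral_toReal ((Kernel.measurable_coe Q hB).aemeasurable) (ae_of_all _ fun x => measure_lt_top _ _)]
  rw [hrepr μ, hrepr ν]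
  exact abs_integral_sub_integral_le_of_setwise hδ ((Kernel.measurable_coe Q hB).ennreal_toReal)
    (fun x => ENNReal.toReal_nonneg) (fun x => by
      simpa only [measureReal_def] using (measureReal_le_one (μ := Q x) (s := B)))

/-- **Nor do its iterates**: `|μQⁿ(B) − νQⁿ(B)| ≤ δ` for every `n`. [ours] -/
theorem iterate_bind_real_sub_abs_le (Q : Kernel Ω Ω) [IsMarkovKernel Q] {δ : ℝ} :
    ∀ (n : ℕ) (μ ν : Measure Ω) [IsProbabilityMeasure μ] [IsProbabilityMeasure ν],
      (∀ C, MeasurableSet C → |μ.real C - ν.real C| ≤ δ) → ∀ {B : Set Ω}, MeasurableSet B →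
        |((fun m : Measure Ω => m.bind Q)^[n] μ).real B - ((fun m : Measure Ω => m.bind Q)^[n] ν).real B| ≤ δ
  | 0, μ, ν, _, _, hδ, B, hB => by simpa using hδ B hB
  | n + 1, μ, ν, _, _, hδ, B, hB => by
    haveI : IsProbabilityMeasure (μ.bind Q) :=
      ⟨by rw [Measure.bind_apply MeasurableSet.univ (Kernel.aemeasurable _)]; simp⟩
    haveI : IsProbabilityMeasure (ν.bind Q) :=
      ⟨by rw [Measure.bind_apply MeasurableSet.univ (Kernel.aemeasurable _)]; simp⟩
    rw [Function.iterate_succ_apply, Function.iterate_succ_apply]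
    exact iterate_bind_real_sub_abs_le Q n (μ.bind Q) (ν.bind Q) (fun C hC => bind_real_sub_abs_le Q μ ν hδ hC) hB

/-! ## §2 The contraction for flow-MCMC: the `π`-parts of the split cancel -/

/-- **`μ₀Kⁿ(B) − ν₀Kⁿ(B) = rⁿ·(μ₀Rⁿ(B) − ν₀Rⁿ(B))`** for `K = indepMH q w`, `w` measurable (a `Fact`), positive, normalised,
maximal at `x₀` with `w(x₀) > 1`, `R` the residual kernel of the exact minorisation `K ≥ (1/w(x₀))·π`; any set `B`. [ours] -/
theorem iterate_bind_indepMH_real_sub_eq_residual [Fact (Measurable w)] (hw0 : ∀ y, 0 < w y) {x₀ : Ω}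
    (hmax : ∀ y, w y ≤ w x₀) (hlt : 1 < w x₀) [IsProbabilityMeasure (q.withDensity fun y => ENNReal.ofReal (w y))]
    (n : ℕ) (μ₀ ν₀ : Measure Ω) [IsProbabilityMeasure μ₀] [IsProbabilityMeasure ν₀] (B : Set Ω) :
    ((fun m : Measure Ω => m.bind (indepMH q w))^[n] μ₀).real B - ((fun m : Measure Ω => m.bind (indepMH q w))^[n] ν₀).real B =
      (1 - (w x₀)⁻¹) ^ n *
        (((fun m : Measure Ω => m.bind
            (Doeblin.residualKernel (indepMH q w) (q.withDensity fun y => ENNReal.ofReal (w y))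
              (ENNReal.ofReal (w x₀)⁻¹) (indepMH_minorised_mode Fact.out hw0 hmax)))^[n] μ₀).real B -
          ((fun m : Measure Ω => m.bind
            (Doeblin.residualKernel (indepMH q w) (q.withDensity fun y => ENNReal.ofReal (w y))
              (ENNReal.ofReal (w x₀)⁻¹) (indepMH_minorised_mode Fact.out hw0 hmax)))^[n] ν₀).real B) := by
  have hW : 1 ≤ w x₀ := hlt.le
  have hr0 : 0 ≤ 1 - (w x₀)⁻¹ := sub_nonneg.2 (inv_le_one_of_one_le₀ hW)
  have hr1 : 1 - (w x₀)⁻¹ ≤ 1 := sub_le_self _ (inv_nonneg.mpr (hw0 x₀).le)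
  have hc0 : 0 ≤ 1 - (1 - (w x₀)⁻¹) ^ n := sub_nonneg.2 (pow_le_one₀ hr0 hr1)
  have hreal : ∀ (m : Measure Ω) [IsProbabilityMeasure m],
      ((fun m : Measure Ω => m.bind (indepMH q w))^[n] m).real B =
        (1 - (1 - (w x₀)⁻¹) ^ n) * (q.withDensity fun y => ENNReal.ofReal (w y)).real B +
          (1 - (w x₀)⁻¹) ^ n * ((fun m : Measure Ω => m.bind
            (Doeblin.residualKernel (indepMH q w) (q.withDensity fun y => ENNReal.ofReal (w y))
              (ENNReal.ofReal (w x₀)⁻¹) (indepMH_minorised_mode Fact.out hw0 hmax)))^[n] m).real B := by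
    intro m _
    simp only [measureReal_def]
    rw [iterate_bind_indepMH_eq_residual_mixture hw0 hmax hlt n m, Measure.add_apply, Measure.smul_apply,
      Measure.smul_apply, smul_eq_mul, smul_eq_mul,
      ENNReal.toReal_add (ENNReal.mul_ne_top ENNReal.ofReal_ne_top (measure_ne_top _ _))
        (ENNReal.mul_ne_top ENNReal.ofReal_ne_top ?_),
      ENNReal.toReal_mul, ENNReal.toReal_mul, ENNReal.toReal_ofReal hc0, ENNReal.toReal_ofReal (pow_nonneg hr0 n)]
    haveI := Doeblin.isMarkovKernel_residualKernel (κ := indepMH q w)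
      (ν := q.withDensity fun y => ENNReal.ofReal (w y)) (ε := ENNReal.ofReal (w x₀)⁻¹)
      (hmin := indepMH_minorised_mode Fact.out hw0 hmax) (ofReal_inv_lt_one_of_one_lt hlt)
    haveI := isProbabilityMeasure_iterate_bind
      (κ := Doeblin.residualKernel (indepMH q w) (q.withDensity fun y => ENNReal.ofReal (w y))
        (ENNReal.ofReal (w x₀)⁻¹) (indepMH_minorised_mode Fact.out hw0 hmax)) m n
    exact measure_ne_top _ _
  rw [hreal μ₀, hreal ν₀]
  ring

/-- **TOTAL-VARIATION CONTRACTION FROM EVERY PAIR OF STARTS (def-free Dobrushin).**  `w` measurable (a `Fact`), positive,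
normalised, maximal at `x₀` (`r = 1 − 1/w(x₀)`).  If two initial laws satisfy `|μ₀(C) − ν₀(C)| ≤ δ` for every measurable
`C`, then for every `n` and measurable `B`: `|μ₀Kⁿ(B) − ν₀Kⁿ(B)| ≤ rⁿ·δ`. [ours] -/
theorem iterate_bind_indepMH_tv_contraction [Fact (Measurable w)] (hw0 : ∀ y, 0 < w y) {x₀ : Ω}
    (hmax : ∀ y, w y ≤ w x₀) [IsProbabilityMeasure (q.withDensity fun y => ENNReal.ofReal (w y))]
    (n : ℕ) (μ₀ ν₀ : Measure Ω) [IsProbabilityMeasure μ₀] [IsProbabilityMeasure ν₀] {δ : ℝ}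
    (hδ : ∀ C, MeasurableSet C → |μ₀.real C - ν₀.real C| ≤ δ) {B : Set Ω} (hB : MeasurableSet B) :
    |((fun m : Measure Ω => m.bind (indepMH q w))^[n] μ₀).real B -
        ((fun m : Measure Ω => m.bind (indepMH q w))^[n] ν₀).real B| ≤ (1 - (w x₀)⁻¹) ^ n * δ := by
  have hW : 1 ≤ w x₀ := one_le_of_mode (q := q) hmax
  have hr0 : 0 ≤ 1 - (w x₀)⁻¹ := sub_nonneg.2 (inv_le_one_of_one_le₀ hW)
  have hδ0 : 0 ≤ δ := by simpa using hδ ∅ MeasurableSet.empty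
  rcases hW.lt_or_eq with hlt | h1
  · haveI := Doeblin.isMarkovKernel_residualKernel (κ := indepMH q w)
      (ν := q.withDensity fun y => ENNReal.ofReal (w y)) (ε := ENNReal.ofReal (w x₀)⁻¹)
      (hmin := indepMH_minorised_mode Fact.out hw0 hmax) (ofReal_inv_lt_one_of_one_lt hlt)
    rw [iterate_bind_indepMH_real_sub_eq_residual hw0 hmax hlt n μ₀ ν₀ B, abs_mul, abs_of_nonneg (pow_nonneg hr0 n)]
    exact mul_le_mul_of_nonneg_left (iterate_bind_real_sub_abs_le _ n μ₀ ν₀ hδ hB) (pow_nonneg hr0 n)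
  · -- `w(x₀) = 1`: the sampler is i.i.d., `mKⁿ = π` for every start and `n ≥ 1`
    rcases n with _ | n
    · simpa using hδ B hB
    · have hstep : ∀ (m : Measure Ω) [IsProbabilityMeasure m],
          m.bind (indepMH q w) = q.withDensity fun y => ENNReal.ofReal (w y) := by
        intro m _
        ext C hC
        rw [Measure.bind_apply hC (Kernel.aemeasurable _)]
        simp_rw [indepMH_apply_eq_target_of_mode_eq_one Fact.out hw0 hmax h1.symm]
        rw [lintegral_const, measure_univ, mul_one]
      haveI := isProbabilityMeasure_iterate_bind (κ := indepMH q w) μ₀ n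
      haveI := isProbabilityMeasure_iterate_bind (κ := indepMH q w) ν₀ n
      rw [Function.iterate_succ_apply', Function.iterate_succ_apply', hstep, hstep, sub_self, abs_zero]
      exact mul_nonneg (pow_nonneg hr0 _) hδ0

/-- **OBSERVABLES FROM TWO CLOSE STARTS**: under the same hypothesis, for measurable `a ≤ g ≤ c` and every `n`:
`|E_{μ₀} g(X_n) − E_{ν₀} g(X_n)| ≤ rⁿ·δ·(c − a)`. [ours] -/
theorem integral_iterate_bind_indepMH_sub_abs_le_of_setwise [Fact (Measurable w)] (hw0 : ∀ y, 0 < w y) {x₀ : Ω}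
    (hmax : ∀ y, w y ≤ w x₀) [IsProbabilityMeasure (q.withDensity fun y => ENNReal.ofReal (w y))]
    (n : ℕ) (μ₀ ν₀ : Measure Ω) [IsProbabilityMeasure μ₀] [IsProbabilityMeasure ν₀] {δ : ℝ}
    (hδ : ∀ C, MeasurableSet C → |μ₀.real C - ν₀.real C| ≤ δ) {g : Ω → ℝ} (hg : Measurable g) {a c : ℝ}
    (ha : ∀ x, a ≤ g x) (hc : ∀ x, g x ≤ c) :
    |∫ x, g x ∂((fun m : Measure Ω => m.bind (indepMH q w))^[n] μ₀) -
        ∫ x, g x ∂((fun m : Measure Ω => m.bind (indepMH q w))^[n] ν₀)| ≤ (1 - (w x₀)⁻¹) ^ n * δ * (c - a) := by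
  haveI := isProbabilityMeasure_iterate_bind (κ := indepMH q w) μ₀ n
  haveI := isProbabilityMeasure_iterate_bind (κ := indepMH q w) ν₀ n
  have h := abs_integral_sub_integral_le_mul_of_setwise ((fun m : Measure Ω => m.bind (indepMH q w))^[n] μ₀)
    ((fun m : Measure Ω => m.bind (indepMH q w))^[n] ν₀)
    (fun C hC => iterate_bind_indepMH_tv_contraction hw0 hmax n μ₀ ν₀ hδ hC) hg ha hc
  linarith

/-! ## §3 Against the target: the rate times the initial distance -/

/-- **`|μ₀Kⁿ(B) − π(B)| ≤ rⁿ·δ` whenever `|μ₀(C) − π(C)| ≤ δ` on measurable sets** — the any-start rate `rⁿ` of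
`IMHAnyStartSplit` multiplied by the initial set-wise distance to the target (`π` is invariant: `πKⁿ = π`). [ours] -/
theorem iterate_bind_indepMH_tv_to_target [Fact (Measurable w)] (hw0 : ∀ y, 0 < w y) {x₀ : Ω}
    (hmax : ∀ y, w y ≤ w x₀) [IsProbabilityMeasure (q.withDensity fun y => ENNReal.ofReal (w y))]
    (n : ℕ) (μ₀ : Measure Ω) [IsProbabilityMeasure μ₀] {δ : ℝ}
    (hδ : ∀ C, MeasurableSet C → |μ₀.real C - (q.withDensity fun y => ENNReal.ofReal (w y)).real C| ≤ δ)
    {B : Set Ω} (hB : MeasurableSet B) :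
    |((fun m : Measure Ω => m.bind (indepMH q w))^[n] μ₀).real B -
        (q.withDensity fun y => ENNReal.ofReal (w y)).real B| ≤ (1 - (w x₀)⁻¹) ^ n * δ := by
  have hinv : (q.withDensity fun y => ENNReal.ofReal (w y)).bind (indepMH q w) =
      q.withDensity fun y => ENNReal.ofReal (w y) := (indepMH_invariant (q := q) Fact.out hw0).def
  have hfix : (fun m : Measure Ω => m.bind (indepMH q w))^[n] (q.withDensity fun y => ENNReal.ofReal (w y)) =
      q.withDensity fun y => ENNReal.ofReal (w y) := by
    induction n with
    | zero => rfl
    | succ n ih => rw [Function.iterate_succ_apply, hinv, ih]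
  have h := iterate_bind_indepMH_tv_contraction (q := q) hw0 hmax n μ₀ (q.withDensity fun y => ENNReal.ofReal (w y)) hδ hB
  rwa [hfix] at h

end Summit.Ventures.LatticeQCDFlow.Exactness

end
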